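import Summits.AnomalousDissipation.AnomalousDissipation.Theorems.MarginalStabilityChainStrainedLayerLawClockEnstrophyMeanFloorReduction
import Summits.AnomalousDissipation.AnomalousDissipation.Theorems.MarginalStabilityChainStrainedLayerLawClockEnstrophyMeanFloorConverse
import HarnessLib

/-!
# Crux `MarginalStabilityChain.StrainedLayerLaw` (stmt-AnomalousDissipation-3007), line `FirstLemmasR2K4`
# (log-enstrophy clock + Nash roundness): under the class repair the crux IS the enstrophy mean floor

Support file (`--supports stmt-AnomalousDissipation-3007`; registered sub-goal
`strainedLayerLaw_iff_enstrophyMeanFloor` of line `FirstLemmasR2K4`, lead c7).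

What it proves: under the recommended class repair (hrepair) — every member `(u, v, p)` of the crux's class
`InCruxClass ν L θ₁ θ₂ u v p` (admissible `θ`, `ν, L > 0`) has shear-layer tails `HasShearLayerTails u v`
(`Literature/Analysis/FluidPDE/StretchedLayerShearTails.lean`) — the crux `StrainedLayerLaw` is EQUIVALENT, with the
SAME constant `c`, to the ENSTROPHY MEAN FLOOR

  (EMF) `∃ c > 0 ∀ L > 0 ∃ ν₀ > 0 ∃ θ` admissible `∀ ν ∈ (0, ν₀]`, for every finite-dissipation tailed member of the
        class from `U_B^ν + θ` and every `ε > 0`: eventually in `T`, `(c·min(L,1)·L − ε) T ≤ ν ∫_1^T Ω(τ) dτ`,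
        `Ω(τ) = ∫_{x ∈ (0,L]} ∫_y ω(τ)²` (iterated form).

How:
* (⇐) is the landed reduction `StrainedLayerLaw_of_enstrophyMeanFloor` (`…ClockEnstrophyMeanFloorReduction.lean`),
  whose hygiene hypothesis (finite-dissipation members have shear tails on compact time windows) is, under (hrepair),
  the landed `bareClassTails_of_hasShearLayerTails` (`…SumRuleShearTails.lean`) — assembled exactly as in
  `StrainedLayerLaw_of_roundnessFloor_of_hasShearLayerTails` (`…ClockReduction.lean`).
* (⇒) unfolds the crux: its five `θ`-clauses are definitionally `IsAdmissible L θ₁ θ₂`, its hypothesis list on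
  `(u, v, p)` is definitionally `InCruxClass ν L θ₁ θ₂ u v p`, and its conclusion is definitionally
  `ofReal (c·min(L,1)) ≤ meanLayerDissipation ν L u v` (`SumRuleLine.lean` §0, `meanLayerDissipation_def`,
  `layerDissipation_def`); then, member by member, the landed converse `enstrophyMeanFloor_of_meanLayerDissipation`
  (`…ClockEnstrophyMeanFloorConverse.lean`) with `K = c·min(L,1)` and `K' = K − ε/L < K` gives eventually
  `L K' T ≤ ν ∫_1^T Ω`, and `L K' T = (c·min(L,1)·L − ε) T`.

No facts are asserted (the theorem is an equivalence between the crux BY NAME and (EMF) under the hypothesis (hrepair)).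
-/

-- `Summit.<Summit>.<Problem>` is the tree's mandated summit-side namespace (CONVENTIONS §2); for this
-- single-conjunct summit the two coincide, so the duplicate is deliberate.
set_option linter.dupNamespace false

noncomputable section

open scoped Topology ENNReal
open Filter Set Function MeasureTheory

namespace Summit.AnomalousDissipation.AnomalousDissipation.Theorems.StrainedLayerLaw.LogEnstrophyClock

open Literature.Analysis.FluidPDE Literature.Analysis.FluidPDE.StretchedLayer
open Summit.AnomalousDissipation.AnomalousDissipation.Theses.MarginalStabilityChain
open Summit.AnomalousDissipation.AnomalousDissipation.Theorems.StrainedLayerLaw.StrainWorkSumRule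

/-- **Hygiene under the class repair.** If every member of the crux's class has shear-layer tails, then the hygiene
statement of the line (finite-dissipation members have `ExpTails` on every compact time window `[a, b] ⊂ (0, ∞)`)
holds: this is the landed `bareClassTails_of_hasShearLayerTails`, fed with the repair hypothesis (the pattern of
`StrainedLayerLaw_of_roundnessFloor_of_hasShearLayerTails`). [folklore] -/
theorem enstrophyMeanFloorIff_hygiene_of_hasShearLayerTails
    (hrepair : ∀ (ν L : ℝ), 0 < ν → 0 < L → ∀ (θ₁ θ₂ : ℝ → ℝ → ℝ), IsAdmissible L θ₁ θ₂ →
        ∀ (u v p : ℝ → ℝ → ℝ → ℝ), InCruxClass ν L θ₁ θ₂ u v p → HasShearLayerTails u v) :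
    ∀ (ν L : ℝ), 0 < ν → 0 < L → ∀ (θ₁ θ₂ : ℝ → ℝ → ℝ), IsAdmissible L θ₁ θ₂ →
      ∀ (u v p : ℝ → ℝ → ℝ → ℝ), InCruxClass ν L θ₁ θ₂ u v p →
        (∀ T : ℝ, 0 < T → ∫⁻ t in Ioc 0 T, layerDissipation ν L (u t) (v t) ≠ ∞) →
          ∀ a b : ℝ, 0 < a → a < b → ExpTails (Icc a b) u v :=
  fun ν L hν hL θ₁ θ₂ hθ u v p hcl hfin a b ha hab =>
    bareClassTails_of_hasShearLayerTails ν L hν hL θ₁ θ₂ hθ u v p hcl (hrepair ν L hν hL θ₁ θ₂ hθ u v p hcl)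
      hfin a b ha hab

/-- **The real bookkeeping of (⇒).** For `L ≠ 0`: `L (K − ε/L) T = (K L − ε) T`. [folklore] -/
theorem enstrophyMeanFloorIff_level_eq {L : ℝ} (hL : L ≠ 0) (K ε T : ℝ) :
    L * (K - ε / L) * T = (K * L - ε) * T := by
  have h : L * (ε / L) = ε := by field_simp
  rw [mul_sub, h, mul_comm L K]

/-- **The crux, unfolded (⇒, one period).** From `StrainedLayerLaw` with constant `c`: for every `L > 0` there are
`ν₀ > 0` and an admissible `θ` such that every member of the class at `ν ∈ (0, ν₀]` has the mean-dissipation floor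
`ofReal (c·min(L,1)) ≤ meanLayerDissipation ν L u v`. Pure definitional unfolding: the crux's `θ`-clauses are the
conjuncts of `IsAdmissible`, its hypothesis list is `InCruxClass` verbatim, and its inlined `D`/`liminf` are
`layerDissipation`/`meanLayerDissipation` (`SumRuleLine.lean` §0, `meanLayerDissipation_def`, `layerDissipation_def`).
[folklore] -/
theorem enstrophyMeanFloorIff_floor_of_law (h : StrainedLayerLaw) :
    ∃ c : ℝ, 0 < c ∧ ∀ L : ℝ, 0 < L → ∃ ν₀ : ℝ, 0 < ν₀ ∧ ∃ θ₁ θ₂ : ℝ → ℝ → ℝ, IsAdmissible L θ₁ θ₂ ∧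
      ∀ ν : ℝ, 0 < ν → ν ≤ ν₀ → ∀ (u v p : ℝ → ℝ → ℝ → ℝ), InCruxClass ν L θ₁ θ₂ u v p →
        ENNReal.ofReal (c * min L 1) ≤ meanLayerDissipation ν L u v := by
  obtain ⟨c, hc, hmain⟩ := h
  refine ⟨c, hc, fun L hL => ?_⟩
  obtain ⟨ν₀, hν₀, θ₁, θ₂, h1, h2, h3, h4, h5, hlaw⟩ := hmain L hL
  refine ⟨ν₀, hν₀, θ₁, θ₂, ⟨h1, h2, h3, h4, h5⟩, ?_⟩
  intro ν hν hνle u v p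
  exact hlaw ν hν hνle u v p

/-- **Under the class repair the crux IS the enstrophy mean floor (registered sub-goal
`strainedLayerLaw_iff_enstrophyMeanFloor` of line `FirstLemmasR2K4`).** Hypothesis (hrepair): every member of the
crux's class has shear-layer tails (`HasShearLayerTails`). Conclusion: `StrainedLayerLaw ↔` (EMF), the enstrophy mean
floor with the same constant `c` — (⇐) by the landed reduction `StrainedLayerLaw_of_enstrophyMeanFloor` with the
hygiene hypothesis supplied by `bareClassTails_of_hasShearLayerTails` under (hrepair); (⇒) by unfolding the crux to
the member-wise floor `ofReal (c·min(L,1)) ≤ meanLayerDissipation ν L u v` and the landed converse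
`enstrophyMeanFloor_of_meanLayerDissipation` with `K' = c·min(L,1) − ε/L`. [folklore] -/
theorem strainedLayerLaw_iff_enstrophyMeanFloor (hrepair : ∀ (ν L : ℝ), 0 < ν → 0 < L → ∀ (θ₁ θ₂ : ℝ → ℝ → ℝ), IsAdmissible L θ₁ θ₂ → ∀ (u v p : ℝ → ℝ → ℝ → ℝ), InCruxClass ν L θ₁ θ₂ u v p → HasShearLayerTails u v) : StrainedLayerLaw ↔ (∃ c : ℝ, 0 < c ∧ ∀ L : ℝ, 0 < L → ∃ ν₀ : ℝ, 0 < ν₀ ∧ ∃ θ₁ θ₂ : ℝ → ℝ → ℝ, IsAdmissible L θ₁ θ₂ ∧ ∀ ν : ℝ, 0 < ν → ν ≤ ν₀ → ∀ (u v p : ℝ → ℝ → ℝ → ℝ), InCruxClass ν L θ₁ θ₂ u v p → (∀ T : ℝ, 0 < T → ∫⁻ t in Ioc 0 T, layerDissipation ν L (u t) (v t) ≠ ∞) → (∀ a b : ℝ, 0 < a → a < b → ExpTails (Icc a b) u v) → ∀ ε : ℝ, 0 < ε → ∀ᶠ T : ℝ in atTop, (c * min L 1 * L - ε) * T ≤ ν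 * ∫ τ in (1:ℝ)..T, (∫ x in Ioc 0 L, ∫ y, vorticity (u τ) (v τ) x y ^ 2)) := by
  refine ⟨fun h => ?_, fun hF =>
    StrainedLayerLaw_of_enstrophyMeanFloor (enstrophyMeanFloorIff_hygiene_of_hasShearLayerTails hrepair) hF⟩
  -- (⇒): unfold the crux to the member-wise mean-dissipation floor, then the landed converse per member
  obtain ⟨c, hc, hmain⟩ := enstrophyMeanFloorIff_floor_of_law h
  refine ⟨c, hc, fun L hL => ?_⟩
  obtain ⟨ν₀, hν₀, θ₁, θ₂, hθ, hlaw⟩ := hmain L hL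
  refine ⟨ν₀, hν₀, θ₁, θ₂, hθ, ?_⟩
  intro ν hν hνle u v p hcl hfin htails ε hε
  have hfloor : ENNReal.ofReal (c * min L 1) ≤ meanLayerDissipation ν L u v := hlaw ν hν hνle u v p hcl
  have hK : 0 ≤ c * min L 1 := mul_nonneg hc.le (le_min hL.le zero_le_one)
  have hK' : c * min L 1 - ε / L < c * min L 1 := sub_lt_self _ (div_pos hε hL)
  have hev := enstrophyMeanFloor_of_meanLayerDissipation ν L (c * min L 1) hν hL hK u v p hcl.isSolution htails
    hfin hfloor (c * min L 1 - ε / L) hK'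
  filter_upwards [hev] with T hT
  rw [← enstrophyMeanFloorIff_level_eq hL.ne' (c * min L 1) ε T]
  exact hT

end Summit.AnomalousDissipation.AnomalousDissipation.Theorems.StrainedLayerLaw.LogEnstrophyClock

end
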